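import Literature.AnabelianGeometry.AbsoluteAnabelian.AbsTopII.CuspidalizationComparison
import HarnessLib

/-!
# [AbsTopII] §3 over a class `𝒟` of construction data: Corollary 3.3 (i)(ii)(iii) and Corollary 3.4
# (pro-`Σ` elliptic cuspidalization I: Algorithms, II: Comparison) in their printed generality

S. Mochizuki, *Topics in Absolute Anabelian Geometry II: Decomposition Groups and Endomorphisms*
[AbsTopII], §3 pp. 67–70 (manuscript pagination, lit key `paper:url-585b8d0ad0d9`; bib key
`MochizukiAbsTopII2013`); Remarks 3.3.1, 3.3.4, 3.4.1, 3.4.2.  Sequel of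
`AbsTopII/EllipticCuspidalization.lean` (OUTPUT structure `EllipticCuspidalization E`, shape (1)) and
`AbsTopII/EllipticAdmissible.lean` (Def 3.1 over the isogeny-level model; `Cor_3_3_ii` in the special
case `Π = π₁`, `Σ` = all primes) — abc-iut-L4-t6, landed — and of `CuspidalizationComparison.lean`
(the `Π`-chain clause, `HasTerminalChainOfType`).  As there for Cor 3.7/3.8, the statements are typed
HERE with their PRINTED hypotheses "`𝒟` chain-full, rel-isom-DGC holds" BY NAME over
abc-iut-L4-t13's `AbsTopI.ConstructionDataClass`, for an arbitrary prime set `Σ` (the datum's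
`primes`: `Π` geometrically pro-`Σ`), and Remark 3.3.1 becomes the LEMMAS `cor_3_3_iii_of_ex_4_8_i`,
`cor_3_4_of_ex_4_8_i` (PROVED reductions to the named fact `ConstructionDataClass.Ex_4_8_i`).
[IUTchI] cites Cor 3.3 (i), (ii) "applicable in light of [AbsTopI] Example 4.8" for reconstructing
the core `Π_C ⊇ Π_X` (Cor 1.2 p. 39, Ex 4.3 p. 98, Def 5.2 p. 123) and (iii) for `U_X`.

## Typing (cell ruling θ, shape (M))

* Members, `G = Gal(k̄_b/k_b)`, envelope: as in `CuspidalizationComparison.lean` (-- TODO(general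
  form): GSAFG quotients `G = Gal(k̃/k)`, `k̃ ⊊ k̄`).  The §3 scheme-side data of Cor 3.3 / 3.4 for a
  member `X` — Def 3.1 "`X` is `Π`-elliptically admissible" (a primitive here; PRINTED definition =
  `AbsTopII.IsEllipticallyAdmissibleWith` over `IsogenyModel`), its cusps, and the running notation of
  Cor 3.3/3.4: the `k`-core `X → C` (Def 3.1 (a); `Π ⊆ Π_C`), "the open subgroups `Π_D ⊆ Π_C` that
  arise from finite étale double coverings `D → C` that exhibit `C` as semi-elliptic", one such `D`,
  `G' ⊆ G` normal open (`k'`), "`N` a positive integer which is a product of primes of `Σ`", "`V → X`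
  [from] a normal open subgroup `Π_V ⊆ Π` [...] `V → D` [from] an open immersion `Π_V ↪ Π_D`" with
  `V` over `k'`, the resulting `U_X ⊆ X` with "the natural surjection `Π_{U_X} ↠ Π` [relative to `α`]"
  and its cusps — form the MODEL INTERFACE `EllipticModel 𝒟` (no instance in the tree).
* LEVEL.  Items (i), (ii) are typed in the instance `G' = G` (`k' = k`, `C` = the `k`-core of `X`,
  `Δ_C := Ker(Π_C ↠ G)`), which the print allows ("Let `G' ⊆ G` be a normal open subgroup"); Cor 3.4
  is printed at this level ("`Cᵢ` a `kᵢ`-core of `Xᵢ`").  In (iii) `G'` enters through "`V` a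
  hyperbolic curve over `k'`" (`Π_V ⊆ Π ×_G G'`) and the clause "for any `G' ⊆ G` that is sufficiently
  small, where 'sufficiently' depends only on `N`", typed as `∃ G₀` open, `∀` settings with
  `G' ⊆ G₀`.  -- TODO(general form): (i)/(ii) for `G' ⊊ G` (`k'`-cores of `X_{k'}`).
* (i) READING.  Print: "`Π' ⇝ Π_C` [...] may be characterized 'group-theoretically', up to isomorphism
  in `Chain(Π')`, as the unique chain of length `1` in `Chain(Π')`, with associated type-chain `⋎`, such
  that the resulting object of `ÉtLoc(Π')` forms a terminal object of `ÉtLoc(Π')`."  The morphisms of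
  `ÉtLoc(Π) := Chain^{iso-trm}(Π){⋏, ⋎}` are terminal ISOmorphisms ([AbsTopI] Def 4.2 (iv)(v)), for
  which a terminal object would force all objects of `ÉtLoc(Π)` to be isomorphic; the notion meant is
  that of [Mzk6] Rmk 2.1.1 / [Mzk9] §2 quoted by Def 3.1 (a) ("`k`-core" = terminal object of
  `Loc_k(X)`, morphisms = finite étale `k`-morphisms), i.e. terminality with respect to INJECTIVE
  terminal homomorphisms FROM PRO-`Σ` CHAINS (condition (3_Π) of Def 4.2 (iii), `IsProSigmaChain`,
  which abc-iut-L4-t4's `PiChain` leaves to consumers — without it the statement would be false for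
  `Σ ≠ Primes`: a quotient `X → Y` of degree prime to `Σ` yields an `ÉtLoc`-object whose `Δ` is not
  pro-`Σ` and cannot inject into the pro-`Σ` `Δ_C`); typed so (`IsEtLocTerminalFor Σ`,
  `AbsTopII/CuspidalizationComparison.lean`; `IsEtLocTerminal` of `CuspidalizationChains.lean` is the
  case `Σ` = all primes), flagged -- TODO(reading); isomorphy in `Chain(Π)` of two length-`1` chains is
  `LastTermsIsomorphic` (= abc-iut-L4-t13's `PiChainIsoOver (Iso.refl _)` for such chains — TODO-import).
* OUTPUT: the landed structure `EllipticCuspidalization E` (EllipticCuspidalization.lean), whose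
  docstrings speak of "`Π' ↠ G'`": it is level-agnostic and is instantiated HERE at `E = (Π ↠ G)` itself,
  so that its `core` is the `k`-core, its `PiD` the double covering `D → C` over `k`, its `PiV ⊆ Π`
  normal in `Π`, and its `proj` the printed output "`Π_{U_X} ↠ Π`" over `G` (Cor 3.3 (iii)(b)).
* `𝒟`-HYPOTHESIS STRENGTH (audit note R3-N2, abc-iut-L6-t22): abc-iut-L4-t13's `RelIsomDGC` is typed
  slice-wise (`ζ_k = id`, one base index `b`; TODO(general form) there), i.e. WEAKER than [AbsTopI]
  Def 4.6 (ii) as printed; a weaker hypothesis makes the named facts here (and `Cor_3_7`/`Cor_3_8`)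
  nominally STRONGER than print.  They agree at the intended class, whose `Base` is the set of
  isomorphism classes of construction-data fields (one representative each, members transported).
HONEST FRAMING: typed ≠ discharged; nothing here takes a side on [IUTchIII] Cor 3.12.
-/

noncomputable section

open CategoryTheory Topology
open scoped Pointwise

universe u

namespace Literature.AnabelianGeometry.AbsoluteAnabelian.AbsTopII

open Literature.AlgebraicGeometry.Frobenioids (IsSlimGroup)
open Literature.AnabelianGeometry.Anabelioids (IsSigmaInteger)
open FundamentalExtension
open AbsTopI (ConstructionDataClass)

/-! ### The model interface over a class `𝒟` of construction data -/

variable {𝒟 : ConstructionDataClass.{u}}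

/-- MODEL INTERFACE (shape (M); no instance in the tree) for Cor 3.3 / 3.4 over a class `𝒟` of
construction data: for a member `X` over `k_b` (`(𝒟.datum b).ext X` = "`1 → Δ → Π → G → 1`",
`G = Gal(k̄_b/k_b)`, `Π` geometrically pro-`Σ_b`) — its cusps, Def 3.1 "`X` is `Π`-elliptically
admissible" with, for such `X` (Def 3.1 (a): "`X` admits a `k`-core `X → C`"), "`C` a `k`-core of `X`",
`Π ⊆ Π_C`, and "the open subgroups `Π_D ⊆ Π_C` that arise from finite étale double coverings `D → C`
that exhibit `C` as semi-elliptic" (meaningful when `IsEllipticallyAdmissible b X`); and the running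
data of Cor 3.3 (iii) p. 68 / Cor 3.4 pp. 69–70 (`Setting`): one such `D`; "`G' ⊆ G` a normal open subgroup,
corresponding to some finite extension `k'`"; "`N` a positive integer which is a product of primes
[perhaps with multiplicities] of `Σ`; `U ⊆ D` the open subscheme obtained by removing the `N`-torsion
points [...]; `V → X`, `V → D` finite étale coverings, where `V` is a hyperbolic curve over `k'` [...]
`V → X` arises from a normal open subgroup `Π_V ⊆ Π` such that `Gal(V/X) ≅ Π/Π_V` preserves
`U_V := V ×_D U` [...] `V → D` arises from an open immersion `Π_V ↪ Π_D`. Thus, `U_V ⊆ V` descends to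
`U_X ⊆ X`" with "the natural surjection `Π_{U_X} ↠ Π`" [relative to `α`] and the cusps of `U_X`.
[cite: MochizukiAbsTopII2013, Cor 3.3 pp.67-68] -/
structure EllipticModel (𝒟 : ConstructionDataClass.{u}) : Type (u + 1) where
  /-- the cusps of the member `X`, with their decomposition groups in `Π` -/
  cusps : ∀ (b : 𝒟.Base) (X : (𝒟.datum b).Obj), CuspidalData ((𝒟.datum b).ext X)
  /-- Def 3.1: "`X` is `Π`-elliptically admissible" for `π₁(X) ↠ Π` the datum's quotient -/
  IsEllipticallyAdmissible : ∀ b : 𝒟.Base, (𝒟.datum b).Obj → Prop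
  /-- "`C` a `k`-core of `X`" (Def 3.1 (a)): the extension `Π_C ↠ G` … -/
  coreExt : ∀ b : 𝒟.Base, (𝒟.datum b).Obj → FundamentalExtension.{u}
  /-- … with `Π ⊆ Π_C` "the open subgroup determined by `X → C`" -/
  toCore : ∀ (b : 𝒟.Base) (X : (𝒟.datum b).Obj), ((𝒟.datum b).ext X ⟶ coreExt b X)
  /-- `Π ↪ Π_C` is an open injection … -/
  toCore_isOpenInjective : ∀ b X, (toCore b X).IsOpenInjective
  /-- … over `G` (a `k`-morphism) -/
  toCore_gal_bijective : ∀ b X, Function.Bijective (toCore b X).gal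
  /-- "the open subgroups `Π_D ⊆ Π_C` that arise from finite étale double coverings `D → C` that
  exhibit `C` as semi-elliptic [cf. Remark 3.1.1]" -/
  doubleCovers : ∀ b X, Set (Subgroup (coreExt b X).arith)
  /-- the data `(D → C, G', N, U, V, U_X)` of Cor 3.3 (iii) / 3.4 for `X` -/
  Setting : ∀ b : 𝒟.Base, (𝒟.datum b).Obj → Type u
  /-- the chosen `D → C`: `Π_D ⊆ Π_C` … -/
  PiD : ∀ {b : 𝒟.Base} {X : (𝒟.datum b).Obj}, Setting b X → Subgroup (coreExt b X).arith
  /-- … is one of them -/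
  PiD_mem : ∀ {b X} (s : Setting b X), PiD s ∈ doubleCovers b X
  /-- "`G' ⊆ G` a normal open subgroup, corresponding to some finite extension `k'`" … -/
  galOpen : ∀ {b : 𝒟.Base} {X : (𝒟.datum b).Obj}, Setting b X → Subgroup ((𝒟.datum b).ext X).gal
  /-- … normal … -/
  normal_galOpen : ∀ {b X} (s : Setting b X), (galOpen s).Normal
  /-- … open -/
  isOpen_galOpen : ∀ {b X} (s : Setting b X), IsOpen (galOpen s : Set ((𝒟.datum b).ext X).gal)
  /-- "`N` a positive integer which is a product of primes [perhaps with multiplicities] of `Σ`" -/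
  level : ∀ {b : 𝒟.Base} {X : (𝒟.datum b).Obj}, Setting b X → ℕ
  /-- `N` is a `Σ`-integer -/
  level_isSigmaInteger : ∀ {b X} (s : Setting b X), IsSigmaInteger (𝒟.datum b).primes (level s)
  /-- "`V → X` arises from a normal open subgroup `Π_V ⊆ Π`" … -/
  PiV : ∀ {b : 𝒟.Base} {X : (𝒟.datum b).Obj}, Setting b X → Subgroup ((𝒟.datum b).ext X).arith
  /-- … normal … -/
  normal_PiV : ∀ {b X} (s : Setting b X), (PiV s).Normal
  /-- … open … -/
  isOpen_PiV : ∀ {b X} (s : Setting b X), IsOpen (PiV s : Set ((𝒟.datum b).ext X).arith)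
  /-- … "`V` a hyperbolic curve over `k'`": `Π_V ⊆ Π ×_G G'` … -/
  PiV_le : ∀ {b X} (s : Setting b X), PiV s ≤ (galOpen s).comap ((𝒟.datum b).ext X).aug.toMonoidHom
  /-- … "`V → D` arises from an open immersion `Π_V ↪ Π_D`" -/
  map_PiV_le : ∀ {b X} (s : Setting b X), (PiV s).map (toCore b X).arith.toMonoidHom ≤ PiD s
  /-- "the natural surjection `Π_{U_X} ↠ Π` [relative to `α`]" of the resulting `U_X ⊆ X`, where
  `1 → Δ_{U_X} → Π_{U_X} → G → 1` is "the extension of GSAFG-type [obtained] by considering the finite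
  étale Galois coverings of degree a product of primes [...] `∈ Σ` over coverings of `U_X` arising
  from `Π`" … -/
  cuspUX : ∀ {b : 𝒟.Base} {X : (𝒟.datum b).Obj}, Setting b X → Cuspidalization ((𝒟.datum b).ext X)
  /-- … "[In particular, `Δ_U`, `Δ_{U_V}`, and `Δ_{U_X}` are pro-`Σ` groups.]" -/
  proSet_geom_cuspUX : ∀ {b X} (s : Setting b X), IsProSet (cuspUX s).ext.geom (𝒟.datum b).primes
  /-- the cusps of `U_X` (the removed closed points of `X`), decomposition groups in `Π_{U_X}` -/
  cuspsUX : ∀ {b X} (s : Setting b X), CuspidalData (cuspUX s).ext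

namespace EllipticModel

variable (M : EllipticModel 𝒟)

/-- The STANDING HYPOTHESES of Cor 3.3 p. 67 / Cor 3.4 p. 69 on one member (all but the
`𝒟`-hypotheses): "`G` a slim profinite group; `1 → Δ → Π → G → 1` an extension of GSAFG-type [⇒ `Δ`
slim; `Δ ≠ 1`] that admits partial construction data `(k, X, Σ)`, where `k` is of characteristic
zero, and `X` is a `Π`-elliptically admissible hyperbolic orbicurve, such that `([X],[k],Σ) ∈ 𝒟`
[...]. Suppose further that, for some `l ∈ Σ`, the cyclotomic character `G → ℤ_l^×` has open image."
[cite: MochizukiAbsTopII2013, Cor 3.3 p.67] -/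
structure IsCor33Member (b : 𝒟.Base) (X : (𝒟.datum b).Obj) : Prop where
  /-- `([X],[k_b],Σ_b) ∈ 𝒟` -/
  mem : 𝒟.Mem b X
  /-- "`X` is a `Π`-elliptically admissible hyperbolic orbicurve" -/
  ellipticallyAdmissible : M.IsEllipticallyAdmissible b X
  /-- "`G` a slim profinite group" (`G = Gal(k̄_b/k_b)`) -/
  slim : IsSlimGroup ((𝒟.datum b).ext X).gal
  /-- "for some `l ∈ Σ`, the cyclotomic character `G → ℤ_l^×` has open image" -/
  cyclotomic : ∃ (l : ℕ) (_ : Fact l.Prime), l ∈ (𝒟.datum b).primes ∧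
    IsOpen (Set.range (AbsTopIII.cyclotomicChar (𝒟.fld b) l))
  /-- GSAFG-type: `Δ` is slim ([AbsTopI] Def 2.1 (iii)) -/
  geom_slim : IsSlimGroup ((𝒟.datum b).ext X).geom
  /-- `X` a hyperbolic orbicurve: `Δ ≠ 1` -/
  geom_ne_bot : ((𝒟.datum b).ext X).geom ≠ ⊥

/-- Under the standing hypotheses `Π` is slim (abc-iut-L4-t4's `arith_slim_of_geom_slim_of_gal_slim`).
[cite: MochizukiAbsTopII2013, Cor 3.3 p.67] -/
theorem IsCor33Member.arith_slim {M : EllipticModel 𝒟} {b : 𝒟.Base} {X : (𝒟.datum b).Obj}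
    (h : M.IsCor33Member b X) : IsSlimGroup ((𝒟.datum b).ext X).arith :=
  ((𝒟.datum b).ext X).arith_slim_of_geom_slim_of_gal_slim h.geom_slim h.slim

/-! ### Corollary 3.3 (i): the core, group-theoretically -/

/-- A length-`1` `Π`-chain `c` *realizes* the `k`-core `X → C` of the member `X`: its last group is
isomorphic to `Π_C` compatibly with the projections to `G` and, on the rigidification domain, with
`Π ⊆ Π_C` ("the finite étale covering `X_{k'} → C` determines a chain `X_{k'} ⇝ C` [...] whose image
`Π' ⇝ Π_C` in `Chain(Π')`", here `k' = k`). [cite: MochizukiAbsTopII2013, Cor 3.3 (i) p.67] -/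
def RealizesCore (b : 𝒟.Base) (X : (𝒟.datum b).Obj)
    {hP : IsSlimGroup ((𝒟.datum b).ext X).arith} {hΔ : IsSlimGroup ((𝒟.datum b).ext X).geom}
    {hne : ((𝒟.datum b).ext X).geom ≠ ⊥} (c : ((𝒟.datum b).ext X).PiChain (M.cusps b X) hP hΔ hne) :
    Prop :=
  c.typeChain = [ElemOpType.finEtQuot] ∧
    ∃ e : c.last.grp ≃ₜ* (M.coreExt b X).arith,
      (∀ y, (M.coreExt b X).aug (e y) = (M.toCore b X).gal (c.last.proj y)) ∧
        ∀ x : c.last.dom, e (c.last.rig x) = (M.toCore b X).arith x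

/-- **Corollary 3.3 (i)** pp. 67–68 relative to `(𝒟, M)`, instance `G' = G`: under the
`𝒟`-hypotheses and the standing hypotheses, "the finite étale covering `X_{k'} → C` determines a chain
[...] whose image `Π' ⇝ Π_C` in `Chain(Π')` may be characterized 'group-theoretically', up to
isomorphism in `Chain(Π')`, as the unique chain of length `1` in `Chain(Π')`, with associated
type-chain `⋎`, such that the resulting object of `ÉtLoc(Π')` forms a terminal object of `ÉtLoc(Π')`"
— TYPED: some length-`1` `⋎`-chain of `Π` [with (3_Π): each `Δⱼ` pro-`Σ`] realizes the `k`-core and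
is `ÉtLoc`-terminal among pro-`Σ` chains (`IsEtLocTerminalFor Σ`, see the module docstring for the
reading), and every such length-`1` `⋎`-chain that is `ÉtLoc`-terminal is isomorphic to it in
`Chain(Π)`.  -- TODO(general form): `G' ⊊ G` (the `k'`-core of
`X_{k'}`, chains of `Π' = Π ×_G G'`); typed: the instance `G' = G`. [cite: MochizukiAbsTopII2013, Cor 3.3 (i) p.67] -/
def Cor_3_3_i : Prop :=
  𝒟.IsChainFull → 𝒟.RelIsomDGC →
    ∀ (b : 𝒟.Base) (X : (𝒟.datum b).Obj) (h : M.IsCor33Member b X),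
      ∃ c : ((𝒟.datum b).ext X).PiChain (M.cusps b X) h.arith_slim h.geom_slim h.geom_ne_bot,
        IsProSigmaChain (𝒟.datum b).primes c ∧ M.RealizesCore b X c ∧
          IsEtLocTerminalFor (𝒟.datum b).primes c ∧
          ∀ c' : ((𝒟.datum b).ext X).PiChain (M.cusps b X) h.arith_slim h.geom_slim h.geom_ne_bot,
            IsProSigmaChain (𝒟.datum b).primes c' → c'.typeChain = [ElemOpType.finEtQuot] →
              IsEtLocTerminalFor (𝒟.datum b).primes c' → LastTermsIsomorphic c' c

/-! ### Corollary 3.3 (ii): the semi-elliptic double coverings, group-theoretically -/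

/-- **Corollary 3.3 (ii)** p. 68 relative to `(𝒟, M)`, instance `G' = G`: under the hypotheses,
"the collection of open subgroups `Π_D ⊆ Π_C` that arise from finite étale double coverings `D → C`
that exhibit `C` as semi-elliptic [cf. Remark 3.1.1] may be characterized 'group-theoretically' as
the collection of open subgroups `J ⊆ Π_C` of index `2` such that `J ∩ Δ_C` [where
`Δ_C := Ker(Π_C ↠ G')`] is torsion-free" — the REAL right-hand side is the landed
`semiEllipticDoubleCoverSubgroups` (EllipticAdmissible.lean).  -- TODO(general form): `G' ⊊ G` (the
`k'`-core of `X_{k'}`); typed: the instance `G' = G`. [cite: MochizukiAbsTopII2013, Cor 3.3 (ii) p.68] -/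
def Cor_3_3_ii : Prop :=
  𝒟.IsChainFull → 𝒟.RelIsomDGC →
    ∀ (b : 𝒟.Base) (X : (𝒟.datum b).Obj), M.IsCor33Member b X →
      M.doubleCovers b X = semiEllipticDoubleCoverSubgroups (M.coreExt b X)

/-! ### Corollary 3.3 (iii): the cuspidalization `Π_{U_X} ↠ Π`, group-theoretically -/

/-- The output `C : EllipticCuspidalization` *matches the setting* `s`: same `N` and `Σ`, its core is
the `k`-core (an isomorphism of extensions under `Π`, carrying `C.PiD` to `Π_D`), its `Π_V` is the
given one, its output `Π_{U_X} ↠ Π` is isomorphic over `Π` to the natural surjection [relative to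
`α`], and "(c) the decomposition groups of the closed points of `X` lying in the complement of `U_X`
[are] the images via `Π_{U_X} ↠ Π` of the cuspidal decomposition groups of `Π_{U_X}`" (same images as
the model's). [cite: MochizukiAbsTopII2013, Cor 3.3 (iii) p.68] -/
def Matches {b : 𝒟.Base} {X : (𝒟.datum b).Obj} (s : M.Setting b X)
    (C : EllipticCuspidalization ((𝒟.datum b).ext X)) : Prop :=
  C.N = M.level s ∧ C.Sigma = (𝒟.datum b).primes ∧
    (∃ e : C.core ≅ M.coreExt b X, C.toCore ≫ e.hom = M.toCore b X ∧
      C.PiD.map e.hom.arith.toMonoidHom = M.PiD s) ∧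
    C.PiV = M.PiV s ∧ C.toCuspidalization.IsoOver (M.cuspUX s) ∧
    C.toCuspidalization.decompositionImages C.cusps =
      (M.cuspUX s).decompositionImages (M.cuspsUX s)

/-- **Corollary 3.3 (iii)** pp. 68–69 relative to `(𝒟, M)`: under the `𝒟`-hypotheses and the standing
hypotheses, "for any `G' ⊆ G` that is sufficiently small, where 'sufficiently' depends only on `N`,
the natural surjection `Π_{U_X} ↠ Π` — i.e., 'cuspidalization' of `Π` — may be constructed via
'group-theoretic' operations as follows: (a) There exists a [not necessarily unique] `Π`-chain, which
admits an entirely 'group-theoretic' description, with associated type-chain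
`⋏, ⋎, ⋏, •, …, •, ⋏, ⋎` — cf. Example 3.2, (ii) — that admits a terminal isomorphism with the
trivial `Π`-chain [of length `0`], and whose final three groups consist of `Π_D ⇝ Π_V ⇝ Π` [...];
(b) [...] by forming the `⋊^out` [...]; (c) [decomposition groups]."  TYPED: for every `N` there is
an open `G₀ ⊆ G` such that for every setting with this `N` and `G' ⊆ G₀` some
`EllipticCuspidalization` of `Π ↠ G` matches the setting (`Matches`) and its type-chain / `Π_V` are
those of a genuine pro-`Σ` `Π`-chain with a terminal isomorphism to the trivial chain
(`HasProSigmaTerminalChainOfType`). [cite: MochizukiAbsTopII2013, Cor 3.3 (iii) pp.68-69] -/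
def Cor_3_3_iii : Prop :=
  𝒟.IsChainFull → 𝒟.RelIsomDGC →
    ∀ (b : 𝒟.Base) (X : (𝒟.datum b).Obj) (h : M.IsCor33Member b X) (N : ℕ),
      ∃ G₀ : Subgroup ((𝒟.datum b).ext X).gal, IsOpen (G₀ : Set ((𝒟.datum b).ext X).gal) ∧
        ∀ s : M.Setting b X, M.level s = N → M.galOpen s ≤ G₀ →
          ∃ C : EllipticCuspidalization ((𝒟.datum b).ext X), M.Matches s C ∧
            HasProSigmaTerminalChainOfType (𝒟.datum b).primes (M.cusps b X) h.arith_slim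
              h.geom_slim h.geom_ne_bot C.typeChain C.PiV

/-! ### Corollary 3.4 (Pro-`Σ` Elliptic Cuspidalization II: Comparison) -/

/-- **Corollary 3.4** pp. 69–70 relative to `(𝒟, M)`: "Let `𝒟` be a chain-full set of collections
of partial construction data such that the rel-isom-DGC holds.  For `i = 1, 2`, let [`Xᵢ` over `kᵢ` be
members satisfying the standing hypotheses with settings: `Cᵢ` a `kᵢ`-core of `Xᵢ`; `Dᵢ → Cᵢ` [...];
`N` a positive integer which is a product of primes `∈ Σ₁ ∩ Σ₂` [ONE `N`]; `Uᵢ`, `Vᵢ`, `U_{Xᵢ}`;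
`Π_{U_{Xᵢ}} ↠ Πᵢ` the natural surjection].  Suppose further that, for some `l ∈ Σ₁ ∩ Σ₂`, the
cyclotomic characters `Gᵢ → ℤ_l^×` have open image for `i = 1, 2` [ONE COMMON `l`].  Let
`φ : Π₁ ⥲ Π₂` be an isomorphism of profinite groups such that `φ(Δ₁) = Δ₂`.  Then there exists an
isomorphism of profinite groups `φ_U : Π_{U_{X₁}} ⥲ Π_{U_{X₂}}` that is compatible with `φ`, relative
to the natural surjections `Π_{U_{Xᵢ}} ↠ Πᵢ`.  Moreover, such an isomorphism is unique up to
composition with an inner automorphism arising from an element of the kernel of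
`Π_{U_{Xᵢ}} ↠ Πᵢ`." [cite: MochizukiAbsTopII2013, Cor 3.4 pp.69-70] -/
def Cor_3_4 : Prop :=
  𝒟.IsChainFull → 𝒟.RelIsomDGC →
    ∀ (b₁ b₂ : 𝒟.Base) (X₁ : (𝒟.datum b₁).Obj) (X₂ : (𝒟.datum b₂).Obj),
      M.IsCor33Member b₁ X₁ → M.IsCor33Member b₂ X₂ →
      ∀ (s₁ : M.Setting b₁ X₁) (s₂ : M.Setting b₂ X₂), M.level s₁ = M.level s₂ →
        IsSigmaInteger ((𝒟.datum b₁).primes ∩ (𝒟.datum b₂).primes) (M.level s₁) →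
        (∃ (l : ℕ) (_ : Fact l.Prime), l ∈ (𝒟.datum b₁).primes ∧ l ∈ (𝒟.datum b₂).primes ∧
          IsOpen (Set.range (AbsTopIII.cyclotomicChar (𝒟.fld b₁) l)) ∧
          IsOpen (Set.range (AbsTopIII.cyclotomicChar (𝒟.fld b₂) l))) →
        ∀ φ : ((𝒟.datum b₁).ext X₁).arith ≃ₜ* ((𝒟.datum b₂).ext X₂).arith,
          ((𝒟.datum b₁).ext X₁).geom.map φ.toMonoidHom = ((𝒟.datum b₂).ext X₂).geom →
          (∃ φU : (M.cuspUX s₁).ext.arith ≃ₜ* (M.cuspUX s₂).ext.arith,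
              ∀ x, (M.cuspUX s₂).hom.arith (φU x) = φ ((M.cuspUX s₁).hom.arith x)) ∧
          ∀ φU φU' : (M.cuspUX s₁).ext.arith ≃ₜ* (M.cuspUX s₂).ext.arith,
            (∀ x, (M.cuspUX s₂).hom.arith (φU x) = φ ((M.cuspUX s₁).hom.arith x)) →
            (∀ x, (M.cuspUX s₂).hom.arith (φU' x) = φ ((M.cuspUX s₁).hom.arith x)) →
              ∃ g : (M.cuspUX s₂).ext.arith, (M.cuspUX s₂).hom.arith g = 1 ∧
                ∀ x, φU' x = g * φU x * g⁻¹

/-- Cor 3.4 for `φ = id` and ONE setting of one member yields an automorphism `φ_U` of `Π_{U_X}` over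
`Π` (the identity qualifies): sanity consequence showing how the hypotheses are instantiated (common
`N` = `N`, common `l` from the member's cyclotomic hypothesis), PROVED from `Cor_3_4`.
[cite: MochizukiAbsTopII2013, Cor 3.4 pp.69-70] -/
theorem Cor_3_4.self_iso {M : EllipticModel 𝒟} (h : M.Cor_3_4) (hfull : 𝒟.IsChainFull)
    (hGC : 𝒟.RelIsomDGC) {b : 𝒟.Base} {X : (𝒟.datum b).Obj} (hX : M.IsCor33Member b X)
    (s : M.Setting b X) :
    ∃ φU : (M.cuspUX s).ext.arith ≃ₜ* (M.cuspUX s).ext.arith,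
      ∀ x, (M.cuspUX s).hom.arith (φU x) = (M.cuspUX s).hom.arith x := by
  obtain ⟨l, hl, hmem, hopen⟩ := hX.cyclotomic
  have hN : IsSigmaInteger ((𝒟.datum b).primes ∩ (𝒟.datum b).primes) (M.level s) := by
    rw [Set.inter_self]
    exact M.level_isSigmaInteger s
  obtain ⟨⟨φU, hφU⟩, -⟩ := h hfull hGC b b X X hX hX s s rfl hN ⟨l, hl, hmem, hmem, hopen, hopen⟩
    (ContinuousMulEquiv.refl _) (by
      ext x
      simp only [Subgroup.mem_map]
      constructor
      · rintro ⟨y, hy, rfl⟩; exact hy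
      · exact fun hx => ⟨x, hx, rfl⟩)
  exact ⟨φU, fun x => hφU x⟩

/-! ### Remark 3.3.1: the `𝒟` of [AbsTopI] Example 4.8 (i) -/

/-- **Remark 3.3.1** p. 69, as a LEMMA: "if one takes `𝔽` to be the set of isomorphism classes of
generalized sub-`p`-adic fields, `𝕊` the set of sets of prime numbers containing `p`, and `𝕍` to be
the set of isomorphism classes of hyperbolic orbicurves over fields whose isomorphism class `∈ 𝔽`,
then `𝒟 := 𝕍 × 𝔽 × 𝕊` satisfies the hypothesis of Corollary 3.3 concerning '`𝒟`' [cf. [AbsTopI]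
Example 4.8, (i)]" — and Example 4.8 (i) also supplies "`G` slim" and "`p` serves as the prime `l`"
(`p ∈ Σ`, `χ_p` open): over such a class (abc-iut-L4-t13's `IsEx48ClassGen p`, named fact
`Ex_4_8_i p`) a `Π`-elliptically admissible member with slim nontrivial `Δ` satisfies every standing
hypothesis. [cite: MochizukiAbsTopII2013, Rmk 3.3.1 p.69] -/
theorem isCor33Member_of_ex_4_8_i {p : ℕ} [Fact p.Prime] (h𝒟 : 𝒟.IsEx48ClassGen p)
    (hEx : 𝒟.Ex_4_8_i p) {b : 𝒟.Base} {X : (𝒟.datum b).Obj} (hmem : 𝒟.Mem b X)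
    (hadm : M.IsEllipticallyAdmissible b X) (hΔ : IsSlimGroup ((𝒟.datum b).ext X).geom)
    (hne : ((𝒟.datum b).ext X).geom ≠ ⊥) : M.IsCor33Member b X where
  mem := hmem
  ellipticallyAdmissible := hadm
  slim := (hEx h𝒟).2.2.2 b
  cyclotomic := ⟨p, inferInstance, h𝒟.mem_primes b, (hEx h𝒟).2.2.1 b⟩
  geom_slim := hΔ
  geom_ne_bot := hne

/-- **Cor 3.3 (iii) with Rmk 3.3.1** (PROVED reduction): over the class of [AbsTopI] Ex 4.8 (i), given
the named facts `Ex_4_8_i` and `Cor_3_3_iii`, the cuspidalization statement holds for every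
`Π`-elliptically admissible member (slim nontrivial `Δ`) — no `𝒟`-hypothesis, slimness of `G` or
cyclotomic hypothesis remains ([IUTchI]: "the algorithms of [AbsTopII] Cor 3.3 [...] which are
applicable in light of [AbsTopI] Example 4.8"). [cite: MochizukiAbsTopII2013, Rmk 3.3.1 p.69] -/
theorem cor_3_3_iii_of_ex_4_8_i {p : ℕ} [Fact p.Prime] (h𝒟 : 𝒟.IsEx48ClassGen p)
    (hEx : 𝒟.Ex_4_8_i p) (h33 : M.Cor_3_3_iii) {b : 𝒟.Base} {X : (𝒟.datum b).Obj}
    (hmem : 𝒟.Mem b X) (hadm : M.IsEllipticallyAdmissible b X)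
    (hΔ : IsSlimGroup ((𝒟.datum b).ext X).geom) (hne : ((𝒟.datum b).ext X).geom ≠ ⊥) (N : ℕ) :
    ∃ G₀ : Subgroup ((𝒟.datum b).ext X).gal, IsOpen (G₀ : Set ((𝒟.datum b).ext X).gal) ∧
      ∀ s : M.Setting b X, M.level s = N → M.galOpen s ≤ G₀ →
        ∃ C : EllipticCuspidalization ((𝒟.datum b).ext X), M.Matches s C ∧
          HasProSigmaTerminalChainOfType (𝒟.datum b).primes (M.cusps b X)
            (M.isCor33Member_of_ex_4_8_i h𝒟 hEx hmem hadm hΔ hne).arith_slim hΔ hne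
            C.typeChain C.PiV :=
  h33 (hEx h𝒟).1 (hEx h𝒟).2.1 b X (M.isCor33Member_of_ex_4_8_i h𝒟 hEx hmem hadm hΔ hne) N

/-- **Cor 3.4 with Rmk 3.3.1** (PROVED reduction): over the class of [AbsTopI] Ex 4.8 (i) the common
prime `l` of Cor 3.4 is `l := p` (`p ∈ Σ_b` and `χ_p` open for every construction-data field of the
class), so the comparison holds for any two `Π`-elliptically admissible members and settings with a
common `Σ₁ ∩ Σ₂`-integer `N`, given `Ex_4_8_i` and `Cor_3_4`.
[cite: MochizukiAbsTopII2013, Cor 3.4 pp.69-70] -/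
theorem cor_3_4_of_ex_4_8_i {p : ℕ} [Fact p.Prime] (h𝒟 : 𝒟.IsEx48ClassGen p)
    (hEx : 𝒟.Ex_4_8_i p) (h34 : M.Cor_3_4) {b₁ b₂ : 𝒟.Base} {X₁ : (𝒟.datum b₁).Obj}
    {X₂ : (𝒟.datum b₂).Obj} (hmem₁ : 𝒟.Mem b₁ X₁) (hmem₂ : 𝒟.Mem b₂ X₂)
    (hadm₁ : M.IsEllipticallyAdmissible b₁ X₁) (hadm₂ : M.IsEllipticallyAdmissible b₂ X₂)
    (hΔ₁ : IsSlimGroup ((𝒟.datum b₁).ext X₁).geom) (hne₁ : ((𝒟.datum b₁).ext X₁).geom ≠ ⊥)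
    (hΔ₂ : IsSlimGroup ((𝒟.datum b₂).ext X₂).geom) (hne₂ : ((𝒟.datum b₂).ext X₂).geom ≠ ⊥)
    (s₁ : M.Setting b₁ X₁) (s₂ : M.Setting b₂ X₂) (hN : M.level s₁ = M.level s₂)
    (hNprimes : IsSigmaInteger ((𝒟.datum b₁).primes ∩ (𝒟.datum b₂).primes) (M.level s₁))
    (φ : ((𝒟.datum b₁).ext X₁).arith ≃ₜ* ((𝒟.datum b₂).ext X₂).arith)
    (hφ : ((𝒟.datum b₁).ext X₁).geom.map φ.toMonoidHom = ((𝒟.datum b₂).ext X₂).geom) :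
    (∃ φU : (M.cuspUX s₁).ext.arith ≃ₜ* (M.cuspUX s₂).ext.arith,
        ∀ x, (M.cuspUX s₂).hom.arith (φU x) = φ ((M.cuspUX s₁).hom.arith x)) ∧
      ∀ φU φU' : (M.cuspUX s₁).ext.arith ≃ₜ* (M.cuspUX s₂).ext.arith,
        (∀ x, (M.cuspUX s₂).hom.arith (φU x) = φ ((M.cuspUX s₁).hom.arith x)) →
        (∀ x, (M.cuspUX s₂).hom.arith (φU' x) = φ ((M.cuspUX s₁).hom.arith x)) →
          ∃ g : (M.cuspUX s₂).ext.arith, (M.cuspUX s₂).hom.arith g = 1 ∧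
            ∀ x, φU' x = g * φU x * g⁻¹ :=
  h34 (hEx h𝒟).1 (hEx h𝒟).2.1 b₁ b₂ X₁ X₂
    (M.isCor33Member_of_ex_4_8_i h𝒟 hEx hmem₁ hadm₁ hΔ₁ hne₁)
    (M.isCor33Member_of_ex_4_8_i h𝒟 hEx hmem₂ hadm₂ hΔ₂ hne₂) s₁ s₂ hN hNprimes
    ⟨p, inferInstance, h𝒟.mem_primes b₁, h𝒟.mem_primes b₂, (hEx h𝒟).2.2.1 b₁, (hEx h𝒟).2.2.1 b₂⟩
    φ hφ

end EllipticModel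

/-! ### Remarks 3.3.4, 3.4.1, 3.4.2 (pp. 69–70) — recorded, no claim typed
`Rmk_3_3_4`/`Rmk_3_4_2 : recorded.` "By applying the tempered version of Corollary 3.3 [resp. Corollary
3.4] one may obtain 'explicit reconstruction algorithm versions' [resp. 'pro-`Σ` tempered' versions] of
certain results of [EtTh] [Thm 1.6; Rmk 1.6.1] concerning the étale theta function" (abc-iut-L2-t1's
`Literature.AnabelianGeometry.EtaleTheta`).  `Rmk_3_4_1 : recorded.` "Corollary 3.4 admits a 'tempered
version', when the base fields `kᵢ` involved are MLF's."  No further claim is printed, none typed.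
[cite: MochizukiAbsTopII2013, Rmk 3.4.2 p.70] -/

end Literature.AnabelianGeometry.AbsoluteAnabelian.AbsTopII
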